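import Mathlib
import HarnessLib
import Summits.NavierStokesRegularity.NavierStokesRegularity.Theorems.PoloidalWindowDoorLrcModEntireTwistingTHBranchValues

/-!
# Item `LrcModEntire` (stmt-NavierStokesRegularity-20428), skeleton twist_split v6, CLASS road to `stub_twistingTHGerm` —
# (BRANCH), second half, part 2: the branch object `U = (1−μ)(Θ⁺ − Θ⁻)`, `S = Θ⁺ + Θ⁻` — regularity, signed law, Type-I dictionary

Cell ns-regularity-ideate, seat ns-k2-port-2 g4 (kernel-port lineage; `--supports stmt-NavierStokesRegularity-20428 --as helper`; brick (F5c), sequel of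
`…TwistingTHBranchLaw` (signed law at a point) and `…TwistingTHBranchValues` (branch-value calculus)).  INPUT — the typed (BRANCH) hypothesis of the
LEAD ns-poloidal-K2-p3 g13's memo OSC-LIOUVILLE-g13 v1.5 §5septies, in three blocks, for a class profile `v` (Type-I, continuous, Oseen-mild, div-free,
poloidal) with hot-spot size `√(−t)|v₂| ≤ N`:
(TH-global) a slope `μ` with `∂₂v_b = μ(t,y₂)∂_b v₂` on the whole slab and `uncurry μ ∈ C³` on the open slab;
(SD) the SLOPE DICTIONARY `|μ|, (−t)|∂ₜμ|, √(−t)|∂_zμ|, (−t)|∂_zzμ| ≤ K_μ(1 + z²/(−t))^k` (scale-invariant polynomial bounds; from non-flatness, not here);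
(BR) two BRANCHES `x⁺, x⁻ : (t,z) ↦ ℝ³` of GLOBAL plane maximisers / minimisers of `v₂` (`x±(t,z)₂ = z`), `C²` on the open slab, with the scale-free
branch-slope bound `‖∂_z x±‖ ≤ B₁(1 + z²/(−t))^k`.
OUTPUT, for `U := (1−μ)(Θ⁺ − Θ⁻)`, `S := Θ⁺ + Θ⁻` (`Θ±(t,z) = v₂(t, x±(t,z))`): the ANALYTIC conjuncts of the signed (t,z)-object of
`…TwistingTHOscRoadSigned.eq_zero_of_signedPlaneOscObject_poly` — `contDiffOn_U/S` (joint `C²`), `signedLaw_U` (the SIGNED law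
`U·(∂ₜU + ½∂_z(S·U) − ∂_zzU) ≤ 0` with `∂ₜU = D(uncurry U)(1,0)`, from `signedLaw_at`), and the Type-I dictionary with exponent `2k`:
`abs_U_le` (`√(−t)|U| ≤ 2N(1+K_μ)·P²`), `abs_S_le` (`√(−t)|S| ≤ 2N`); the derivative bounds `Ut_bound`, `Uz_bound`, `Uzz_bound`, `Sz_bound` are in the
sequel `…TwistingTHBranchBounds` (the branch velocities drop out because `∇ₕv₂(x±) = 0`, `…BranchValues`); assembly, plane majorant and the final road:
`…TwistingTHBranchRoad`.

WHAT THIS IS NOT: not a claim about Navier–Stokes regularity and not the stub — (BR)+(SD) is the typed wall, assumed here, not proved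
(bears_on LADDER-NS N0, item 20428 / crux 19708; both OPEN).
-/

noncomputable section

-- the summit and its single sub-problem share the name (CONVENTIONS §1), as in every Theorems file
set_option linter.dupNamespace false

namespace Summit.NavierStokesRegularity.NavierStokesRegularity.Theorems.PoloidalWindowDoorLrcModEntireTwistingTHBranchObject

open Set Function Filter Topology
open scoped RealInnerProductSpace InnerProductSpace
open Literature.Analysis Literature.Analysis.FluidPDE
open Summit.NavierStokesRegularity.NavierStokesRegularity.Theorems.PoloidalWindowDoorPoloidalWindowRigidityWindow
open Summit.NavierStokesRegularity.NavierStokesRegularity.Theorems.PoloidalWindowDoorLrcModEntireTwistingTHPlaneOscillation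
open Summit.NavierStokesRegularity.NavierStokesRegularity.Theorems.PoloidalWindowDoorLrcModEntireTwistingTHPlaneOscillationEnvelope
  (differentiable_deriv_of_contDiff_two)
open Summit.NavierStokesRegularity.NavierStokesRegularity.Theorems.PoloidalWindowDoorLrcModEntireTwistingTHBranchLaw
open Summit.NavierStokesRegularity.NavierStokesRegularity.Theorems.PoloidalWindowDoorLrcModEntireTwistingTHBranchValues

/-! ### Generic helpers -/

/-- The time slice of a Fréchet-differentiable `uncurry F`: `s ↦ F(s,z)` has derivative `L(1,0)`. -/
theorem hasDerivAt_time_of_hasFDerivAt {F : ℝ → ℝ → ℝ} {L : ℝ × ℝ →L[ℝ] ℝ} {t z : ℝ} (h : HasFDerivAt (uncurry F) L (t, z)) :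
    HasDerivAt (fun s => F s z) (L (1, 0)) t := by
  have h2 := (h.comp t (hasFDerivAt_prodMk_left t z)).hasDerivAt
  have e : (L.comp (ContinuousLinearMap.inl ℝ ℝ ℝ)) 1 = L (1, 0) := by simp
  rw [e] at h2
  exact h2

/-- Product rule, first and second order, for `C²` functions of one variable. -/
theorem deriv_mul_two {a f : ℝ → ℝ} (ha : ContDiff ℝ 2 a) (hf : ContDiff ℝ 2 f) (z : ℝ) :
    deriv (fun h => a h * f h) z = deriv a z * f z + a z * deriv f z ∧
    deriv (deriv fun h => a h * f h) z = deriv (deriv a) z * f z + 2 * deriv a z * deriv f z + a z * deriv (deriv f) z := by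
  have had : Differentiable ℝ a := ha.differentiable (by norm_num)
  have hfd : Differentiable ℝ f := hf.differentiable (by norm_num)
  have ha' : Differentiable ℝ (deriv a) := differentiable_deriv_of_contDiff_two ha
  have hf' : Differentiable ℝ (deriv f) := differentiable_deriv_of_contDiff_two hf
  have d1 : deriv (fun h => a h * f h) = fun h => deriv a h * f h + a h * deriv f h :=
    funext fun h => deriv_fun_mul (had h) (hfd h)
  refine ⟨by rw [d1], ?_⟩
  have hA1 : DifferentiableAt ℝ (fun h => deriv a h * f h) z := (ha' z).mul (hfd z)
  have hA2 : DifferentiableAt ℝ (fun h => a h * deriv f h) z := (had z).mul (hf' z)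
  rw [d1, deriv_fun_add hA1 hA2, deriv_fun_mul (ha' z) (hfd z), deriv_fun_mul (had z) (hf' z)]
  ring

/-- Polynomial weight facts: `P := (1 + z²/(−t))^k ≥ 1` and `P ≤ P^{(2k)} = P·P` (`t < 0`). -/
theorem poly_facts {t : ℝ} (ht : t < 0) (z : ℝ) (k : ℕ) :
    1 ≤ (1 + z ^ 2 / (-t)) ^ k ∧ (1 + z ^ 2 / (-t)) ^ k ≤ (1 + z ^ 2 / (-t)) ^ (2 * k) ∧
      (1 + z ^ 2 / (-t)) ^ (2 * k) = (1 + z ^ 2 / (-t)) ^ k * (1 + z ^ 2 / (-t)) ^ k := by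
  have hnt : 0 < -t := neg_pos.2 ht
  have hP1 : (1 : ℝ) ≤ (1 + z ^ 2 / (-t)) ^ k :=
    one_le_pow₀ (le_add_of_nonneg_right (div_nonneg (sq_nonneg z) hnt.le))
  have hP2 : (1 + z ^ 2 / (-t)) ^ (2 * k) = (1 + z ^ 2 / (-t)) ^ k * (1 + z ^ 2 / (-t)) ^ k := by rw [two_mul, pow_add]
  exact ⟨hP1, hP2 ▸ le_mul_of_one_le_right (zero_le_one.trans hP1) hP1, hP2⟩

/-- From a bound `X ≤ C₁·P` with `C₁ ≤ K`, `P ≤ P₂`, `0 ≤ P`, `0 ≤ K`: `X ≤ K·P₂`. -/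
theorem le_mul_of_le_mul {X C₁ K P P₂ : ℝ} (h : X ≤ C₁ * P) (hC : C₁ ≤ K) (hP : P ≤ P₂) (hP0 : 0 ≤ P) (hK : 0 ≤ K) : X ≤ K * P₂ :=
  h.trans (mul_le_mul hC hP hP0 hK)

/-! ### The class setting and the (BRANCH) data -/

section Class

variable {C : ℝ} {v : ℝ → EuclideanSpace ℝ (Fin 3) → EuclideanSpace ℝ (Fin 3)}
variable (hrate : HasTypeITimeDecay C v) (hcont : ContinuousOn (uncurry v) (Iio (0 : ℝ) ×ˢ univ))
  (hmild : ∀ s t : ℝ, s < t → t < 0 → ∀ x,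
    v t x = UnboundedOperators.heatExtension (v s) (t - s) x - oseenDuhamel 1 s v v t x)
  (hdiv : ∀ t < 0, VectorCalculus.IsDivFree (v t))
  (hpol : ∀ s < 0, ∀ y, ⟪curl (v s) y, EuclideanSpace.single 2 1⟫_ℝ = 0)
  {N : ℝ} (hN : ∀ t < 0, ∀ x : EuclideanSpace ℝ (Fin 3), Real.sqrt (-t) * |v t x 2| ≤ N)
  {μ : ℝ → ℝ → ℝ}
  (hTH : ∀ s < 0, ∀ y : EuclideanSpace ℝ (Fin 3), ∀ b : Fin 3, b ≠ 2 →
    fderiv ℝ (v s) y (EuclideanSpace.single 2 1) b = μ s (y 2) * fderiv ℝ (v s) y (EuclideanSpace.single b 1) 2)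
  (hμC : ContDiffOn ℝ 3 (uncurry μ) (Iio (0 : ℝ) ×ˢ univ))
  {Kμ : ℝ} {k : ℕ}
  (hμb : ∀ t < 0, ∀ z, |μ t z| ≤ Kμ * (1 + z ^ 2 / (-t)) ^ k)
  (hμt : ∀ t < 0, ∀ z, (-t) * |deriv (fun s => μ s z) t| ≤ Kμ * (1 + z ^ 2 / (-t)) ^ k)
  (hμz : ∀ t < 0, ∀ z, Real.sqrt (-t) * |deriv (μ t) z| ≤ Kμ * (1 + z ^ 2 / (-t)) ^ k)
  (hμzz : ∀ t < 0, ∀ z, (-t) * |deriv (deriv (μ t)) z| ≤ Kμ * (1 + z ^ 2 / (-t)) ^ k)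
  {xp xm : ℝ → ℝ → EuclideanSpace ℝ (Fin 3)}
  (hxp2 : ∀ t < 0, ∀ z, xp t z 2 = z) (hxm2 : ∀ t < 0, ∀ z, xm t z 2 = z)
  (hxpC : ContDiffOn ℝ 2 (uncurry xp) (Iio (0 : ℝ) ×ˢ univ)) (hxmC : ContDiffOn ℝ 2 (uncurry xm) (Iio (0 : ℝ) ×ˢ univ))
  (hmax : ∀ t < 0, ∀ z, ∀ y : EuclideanSpace ℝ (Fin 3), y 2 = z → v t y 2 ≤ v t (xp t z) 2)
  (hmin : ∀ t < 0, ∀ z, ∀ y : EuclideanSpace ℝ (Fin 3), y 2 = z → v t (xm t z) 2 ≤ v t y 2)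
  {B₁ : ℝ}
  (hxpz : ∀ t < 0, ∀ z, ‖deriv (xp t) z‖ ≤ B₁ * (1 + z ^ 2 / (-t)) ^ k)
  (hxmz : ∀ t < 0, ∀ z, ‖deriv (xm t) z‖ ≤ B₁ * (1 + z ^ 2 / (-t)) ^ k)
  {U S : ℝ → ℝ → ℝ}
  (hU : U = fun s h => (1 - μ s h) * (v s (xp s h) 2 - v s (xm s h) 2))
  (hS : S = fun s h => v s (xp s h) 2 + v s (xm s h) 2)

include hrate hcont hmild hdiv

/-- The vertical velocity slice `y ↦ v₂(t,y)` is differentiable. -/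
theorem differentiable_vert {t : ℝ} (ht : t < 0) : Differentiable ℝ fun y : EuclideanSpace ℝ (Fin 3) => v t y 2 := by
  have hVd : Differentiable ℝ (v t) :=
    ((isTypeIAncientMild_of_class hrate hcont hmild hdiv).contDiff_slice ht).differentiable (by simp)
  exact fun y => (EuclideanSpace.proj (𝕜 := ℝ) (2 : Fin 3)).differentiableAt.comp y (hVd y)

include hxp2 hmax in
/-- A GLOBAL plane maximiser branch is horizontally critical. -/
theorem crit_max : ∀ t < 0, ∀ z, ∀ b : Fin 3, b ≠ 2 →
    fderiv ℝ (fun y => v t y 2) (xp t z) (EuclideanSpace.single b 1) = 0 := fun t ht z b hb =>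
  fderiv_horiz_eq_zero_of_planeMax (differentiable_vert hrate hcont hmild hdiv ht)
    (IsMaxOn.localize (fun y hy => hmax t ht z y (by rw [hy, hxp2 t ht z]))) hb

include hxm2 hmin in
/-- A GLOBAL plane minimiser branch is horizontally critical. -/
theorem crit_min : ∀ t < 0, ∀ z, ∀ b : Fin 3, b ≠ 2 →
    fderiv ℝ (fun y => v t y 2) (xm t z) (EuclideanSpace.single b 1) = 0 := fun t ht z b hb =>
  fderiv_horiz_eq_zero_of_planeMin (differentiable_vert hrate hcont hmild hdiv ht)
    (IsMinOn.localize (fun y hy => hmin t ht z y (by rw [hy, hxm2 t ht z]))) hb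

include hμC hxpC hxmC hU in
/-- **`U ∈ C²` on the open slab.** -/
theorem contDiffOn_U : ContDiffOn ℝ 2 (uncurry U) (Iio (0 : ℝ) ×ˢ univ) := by
  have hμ2 : ContDiffOn ℝ 2 (uncurry μ) (Iio (0 : ℝ) ×ˢ univ) := hμC.of_le (by norm_cast)
  have e : uncurry U = fun p : ℝ × ℝ => (1 - uncurry μ p) *
      (uncurry (fun t z => v t (xp t z) 2) p - uncurry (fun t z => v t (xm t z) 2) p) := by
    funext p; subst hU; rfl
  rw [e]
  exact (contDiffOn_const.sub hμ2).mul
    ((contDiffOn_branchValue hrate hcont hmild hdiv hxpC).sub (contDiffOn_branchValue hrate hcont hmild hdiv hxmC))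

include hxpC hxmC hS in
/-- **`S ∈ C²` on the open slab.** -/
theorem contDiffOn_S : ContDiffOn ℝ 2 (uncurry S) (Iio (0 : ℝ) ×ˢ univ) := by
  have e : uncurry S = fun p : ℝ × ℝ => uncurry (fun t z => v t (xp t z) 2) p + uncurry (fun t z => v t (xm t z) 2) p := by
    funext p; subst hS; rfl
  rw [e]
  exact (contDiffOn_branchValue hrate hcont hmild hdiv hxpC).add (contDiffOn_branchValue hrate hcont hmild hdiv hxmC)

include hpol hTH hμC hxp2 hxm2 hxpC hxmC hmax hmin hU hS in
/-- **THE SIGNED LAW for the branch object**, with `∂ₜU` spelled `D(uncurry U)(t,z)(1,0)` (`…TwistingTHBranchLaw.signedLaw_at`). -/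
theorem signedLaw_U : ∀ t < 0, ∀ z,
    U t z * (fderiv ℝ (uncurry U) (t, z) (1, 0) + (1 / 2 : ℝ) * deriv (fun z => S t z * U t z) z - deriv (deriv (U t)) z) ≤ 0 := by
  intro t ht z
  have hUd : HasFDerivAt (uncurry U) (fderiv ℝ (uncurry U) (t, z)) (t, z) :=
    (((contDiffOn_U hrate hcont hmild hdiv hμC hxpC hxmC hU).differentiableOn (by norm_num)).differentiableAt (slab_mem_nhds ht z)).hasFDerivAt
  have hlaw := signedLaw_at hrate hcont hmild hdiv hpol hTH hμC (contDiffOn_branchValue hrate hcont hmild hdiv hxpC)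
    (contDiffOn_branchValue hrate hcont hmild hdiv hxmC)
    (fun s hs y => hmax s hs (y 2) y rfl) (fun s hs y => hmin s hs (y 2) y rfl) hU hS ht (hxp2 t ht z) (hxm2 t ht z) rfl rfl
  rw [(hasDerivAt_time_of_hasFDerivAt hUd).deriv] at hlaw
  exact hlaw

omit hrate hcont hmild hdiv in
include hN hxm2 hmax in
/-- Pointwise size facts: `N ≥ 0`, `0 ≤ Θ⁺ − Θ⁻`, `√(−t)(Θ⁺ − Θ⁻) ≤ 2N`. -/
theorem osc_facts {t : ℝ} (ht : t < 0) (z : ℝ) :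
    0 ≤ N ∧ 0 ≤ v t (xp t z) 2 - v t (xm t z) 2 ∧ Real.sqrt (-t) * (v t (xp t z) 2 - v t (xm t z) 2) ≤ 2 * N := by
  have hN0 : 0 ≤ N := le_trans (by positivity) (hN (-1) (by norm_num) 0)
  have hD0 : 0 ≤ v t (xp t z) 2 - v t (xm t z) 2 := sub_nonneg.2 (hmax t ht z (xm t z) (hxm2 t ht z))
  have hΘp : |v t (xp t z) 2| * Real.sqrt (-t) ≤ N := by rw [mul_comm]; exact hN t ht _
  have hΘm : |v t (xm t z) 2| * Real.sqrt (-t) ≤ N := by rw [mul_comm]; exact hN t ht _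
  have hs : 0 ≤ Real.sqrt (-t) := Real.sqrt_nonneg _
  exact ⟨hN0, hD0, by nlinarith [le_abs_self (v t (xp t z) 2), neg_abs_le (v t (xm t z) 2)]⟩

omit hrate hcont hmild hdiv in
include hμb in
/-- `K_μ ≥ 0` and `|1 − μ| ≤ 1 + K_μ·P`. -/
theorem slope_facts {t : ℝ} (ht : t < 0) (z : ℝ) : 0 ≤ Kμ ∧ |1 - μ t z| ≤ 1 + Kμ * (1 + z ^ 2 / (-t)) ^ k := by
  have hKμ0 : 0 ≤ Kμ := by
    have h := hμb (-1) (by norm_num) 0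
    have e : (1 + (0:ℝ) ^ 2 / (-(-1:ℝ))) ^ k = 1 := by simp
    rw [e, mul_one] at h
    exact (abs_nonneg _).trans h
  exact ⟨hKμ0, (abs_sub (1:ℝ) (μ t z)).trans (by rw [abs_one]; exact add_le_add le_rfl (hμb t ht z))⟩

omit hrate hcont hmild hdiv in
include hN hμb hxm2 hmax hU in
/-- **Size of `U`**: `√(−t)|U(t,z)| ≤ 2N(1 + K_μ)·(1 + z²/(−t))^{2k}`. -/
theorem abs_U_le : ∀ t < 0, ∀ z, Real.sqrt (-t) * |U t z| ≤ 2 * N * (1 + Kμ) * (1 + z ^ 2 / (-t)) ^ (2 * k) := by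
  intro t ht z
  obtain ⟨hN0, hD0, hD⟩ := osc_facts hN hxm2 hmax ht z
  obtain ⟨hKμ0, ha⟩ := slope_facts hμb ht z
  obtain ⟨hP1, hPP, -⟩ := poly_facts ht z k
  set P := (1 + z ^ 2 / (-t)) ^ k
  have hP0 : 0 ≤ P := zero_le_one.trans hP1
  subst hU
  show Real.sqrt (-t) * |(1 - μ t z) * (v t (xp t z) 2 - v t (xm t z) 2)| ≤ 2 * N * (1 + Kμ) * (1 + z ^ 2 / (-t)) ^ (2 * k)
  rw [abs_mul, abs_of_nonneg hD0]
  have h1 : Real.sqrt (-t) * (|1 - μ t z| * (v t (xp t z) 2 - v t (xm t z) 2)) ≤ (1 + Kμ * P) * (2 * N) := by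
    have e : Real.sqrt (-t) * (|1 - μ t z| * (v t (xp t z) 2 - v t (xm t z) 2)) =
        |1 - μ t z| * (Real.sqrt (-t) * (v t (xp t z) 2 - v t (xm t z) 2)) := by ring
    rw [e]
    exact mul_le_mul ha hD (mul_nonneg (Real.sqrt_nonneg _) hD0) (add_nonneg zero_le_one (mul_nonneg hKμ0 hP0))
  have h2 : (1 + Kμ * P) * (2 * N) ≤ (2 * N * (1 + Kμ)) * P := by
    have e : (2 * N * (1 + Kμ)) * P - (1 + Kμ * P) * (2 * N) = 2 * N * (P - 1) := by ring
    rw [← sub_nonneg, e]; exact mul_nonneg (mul_nonneg zero_le_two hN0) (sub_nonneg.2 hP1)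
  exact le_mul_of_le_mul (h1.trans h2) le_rfl hPP hP0 (mul_nonneg (mul_nonneg zero_le_two hN0) (by linarith))

omit hrate hcont hmild hdiv in
include hN hS in
/-- **Size of `S`**: `√(−t)|S(t,z)| ≤ 2N`. -/
theorem abs_S_le : ∀ t < 0, ∀ z, Real.sqrt (-t) * |S t z| ≤ 2 * N := by
  intro t ht z
  subst hS
  show Real.sqrt (-t) * |v t (xp t z) 2 + v t (xm t z) 2| ≤ 2 * N
  have h := abs_add_le (v t (xp t z) 2) (v t (xm t z) 2)
  have hΘp := hN t ht (xp t z)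
  have hΘm := hN t ht (xm t z)
  nlinarith [Real.sqrt_nonneg (-t)]

end Class

end Summit.NavierStokesRegularity.NavierStokesRegularity.Theorems.PoloidalWindowDoorLrcModEntireTwistingTHBranchObject
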